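import Summits.CriticalPhenomena.PercolationContinuityZ3.Theorems.PercNearOneGluingNoHeavyLowerTailSunflowerTBernStarHC
import HarnessLib

/-!
# `NoHeavyLowerTail` (crux stmt-CriticalPhenomena-4575), abstract sunflower cubic: T-BERN — the h-endgame condition (HC)
# for the SUPER-DWARF HUB and an ARBITRARY tight pack (induction on the pack)

Support file (seat `prim-ineq-prove-1` gen 64; `--supports stmt-CriticalPhenomena-4575`).  No `sorry`, no named facts.
Memo: run/shared/lean/prim/prim-ineq-prove-1/FINDING-PACK-prove1-g64.md §1–§2.

Normalised coordinates (memo g63 §0; `…SunflowerTBernStarHC`): `0 ≤ κ ≤ λ ≤ 1`, `μ = 1−λ`, `p = 1−κ`, `D ≥ 1`,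
`γ_D = λD + μ`, `ᾱ = p + K` (`K = κX_T`) with the model identities `μᾱ = pγ_D`, `μK = pλD`.  A TIGHT PACK is a finset `W`
of petals `(x_j, 1, x_j)`, `x_j = 1 + ξ_j`, `0 ≤ ξ_j ≤ D − 1`, with `γ_j = 1 + λξ_j`, `α_j = 1 + κξ_j`,
`θ_j = γ_j/x_j`, deficit `d_j = (λ−κ)ξ_j/γ_j`; `packG = ∏γ_j`, `packT = ∏θ_j`, `packS = Σd_j`.
The state of the SUPER-DWARF HUB `(X_T/∏x_j, 1, D)` after absorbing `W` exactly (`zone_extend_exact`) is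
`G = γ_D·packG`, `A = p·packG + K·packT − G·packS`, and the quantity that (HC) asks to be nonnegative (`star_of_hc`,
`gz = γ_D`) is, after one use of `μᾱ = pγ_D`,
  `phiSD W = λγ_Dᾱ − λγ_D(K·packT + p·packG) + λγ_D²·packS·packG − γ_D²(p − μ·packG)(packG − 1)`.
**`phiSD_nonneg`: `0 ≤ phiSD W` for EVERY tight pack**, by induction on `W`: `phiSD ∅ = 0` and
(**`phiSD_insert`**) `phiSD (insert j W) − γ_j·phiSD W = λξ_jγ_D·B` with
  `B = K·packT(insert j W) + γ_D(μ·g·g' + (p−μ)g) − ᾱ ≥ 0`   (**`packBracket_nonneg`**),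
which follows from `θ_j ≥ γ_D/D` and the pack inequality **`packK_le`**: `K(1 − packT W) ≤ pD(packG W − 1)`.
Also here: the (HC) quantity `phiHC` (= the product form of `star_of_hc`, `phiHC_eq_hc`), its monotonicity in `A` and `gz`,
its `b`-form, and the bridge `phiHC_superdwarf` (`phiHC` of the x-saturated super-dwarf state IS `phiSD`).
(The general hub is reduced to this one in `…SunflowerTBernPack`.)
-/

noncomputable section

namespace Summit.CriticalPhenomena.PercolationContinuityZ3.Theorems.SunflowerPartition

namespace SafeCalc

namespace LinkedCurrency

open Finset

variable {ι : Type*}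

/-! ## Pack quantities -/

/-- `γ`-mass of a tight pack: `∏ (1 + λξ_j)`. [definition, this work] -/
def packG (lam : ℝ) (W : Finset ι) (ξ : ι → ℝ) : ℝ := ∏ j ∈ W, (1 + lam * ξ j)

/-- `Θ` of a tight pack: `∏ (1 + λξ_j)/(1 + ξ_j)`. [definition, this work] -/
def packT (lam : ℝ) (W : Finset ι) (ξ : ι → ℝ) : ℝ := ∏ j ∈ W, (1 + lam * ξ j) / (1 + ξ j)

/-- Deficit sum of a tight pack: `Σ (λ−κ)ξ_j/(1 + λξ_j)`. [definition, this work] -/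
def packS (κ lam : ℝ) (W : Finset ι) (ξ : ι → ℝ) : ℝ := ∑ j ∈ W, (lam - κ) * ξ j / (1 + lam * ξ j)

/-- `1 ≤ packG` for `λ ≥ 0`, `ξ ≥ 0`. [this work] -/
theorem one_le_packG {lam : ℝ} (hl : 0 ≤ lam) (W : Finset ι) {ξ : ι → ℝ} (hξ : ∀ j ∈ W, 0 ≤ ξ j) :
    1 ≤ packG lam W ξ :=
  Pendant.one_le_prod_of_one_le W fun j hj => by nlinarith [mul_nonneg hl (hξ j hj)]

/-- `0 ≤ packT`. [this work] -/
theorem packT_nonneg {lam : ℝ} (hl : 0 ≤ lam) (W : Finset ι) {ξ : ι → ℝ} (hξ : ∀ j ∈ W, 0 ≤ ξ j) :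
    0 ≤ packT lam W ξ :=
  prod_nonneg fun j hj => div_nonneg (by nlinarith [mul_nonneg hl (hξ j hj)]) (by linarith [hξ j hj])

/-- `packT ≤ 1` for `0 ≤ λ ≤ 1`, `ξ ≥ 0`. [this work] -/
theorem packT_le_one {lam : ℝ} (hl : 0 ≤ lam) (hl1 : lam ≤ 1) (W : Finset ι) {ξ : ι → ℝ}
    (hξ : ∀ j ∈ W, 0 ≤ ξ j) : packT lam W ξ ≤ 1 := by
  unfold packT
  refine prod_le_one (fun j hj => div_nonneg (by nlinarith [mul_nonneg hl (hξ j hj)]) (by linarith [hξ j hj]))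
    fun j hj => ?_
  rw [div_le_one (by linarith [hξ j hj])]
  nlinarith [hξ j hj]

/-- `0 ≤ packS` for `κ ≤ λ`, `λ ≥ 0`, `ξ ≥ 0`. [this work] -/
theorem packS_nonneg {κ lam : ℝ} (hκl : κ ≤ lam) (hl : 0 ≤ lam) (W : Finset ι) {ξ : ι → ℝ}
    (hξ : ∀ j ∈ W, 0 ≤ ξ j) : 0 ≤ packS κ lam W ξ :=
  sum_nonneg fun j hj => div_nonneg (mul_nonneg (sub_nonneg.2 hκl) (hξ j hj)) (by nlinarith [mul_nonneg hl (hξ j hj)])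

/-! ## The pack inequality `K(1 − Θ) ≤ pD(g − 1)` -/

/-- One petal: `1 − θ ≤ μξ` for `θ = (1+λξ)/(1+ξ)`, `λ + μ = 1`, `ξ ≥ 0`. [this work] -/
theorem one_sub_theta_le {lam μ e : ℝ} (hμ : μ = 1 - lam) (he : 0 ≤ e) (hμ0 : 0 ≤ μ) :
    1 - (1 + lam * e) / (1 + e) ≤ μ * e := by
  have hx : 0 < 1 + e := by linarith
  have h1 : 1 - μ * e ≤ (1 + lam * e) / (1 + e) := by
    rw [le_div_iff₀ hx]
    nlinarith [mul_nonneg hμ0 (mul_nonneg he he)]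
  linarith

/-- **The pack inequality.**  `K(1 − packT W) ≤ pD(packG W − 1)` whenever `μK = pλD` (`λ, μ, p, K ≥ 0`, `λ+μ = 1`,
`ξ ≥ 0`).  Induction on `W`: one more petal `η` costs `KΘ(1 − θ_η) ≤ K·μη = pλDη ≤ pD·g·λη`. [this work] -/
theorem packK_le [DecidableEq ι] {lam μ p K D : ℝ} (hl : 0 ≤ lam) (hl1 : lam ≤ 1) (hμ : μ = 1 - lam) (hp : 0 ≤ p)
    (hK0 : 0 ≤ K) (hD : 1 ≤ D) (hK : μ * K = p * lam * D) (W : Finset ι) {ξ : ι → ℝ} (hξ : ∀ j ∈ W, 0 ≤ ξ j) :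
    K * (1 - packT lam W ξ) ≤ p * D * (packG lam W ξ - 1) := by
  have hμ0 : 0 ≤ μ := by rw [hμ]; linarith
  induction W using Finset.induction_on with
  | empty => simp [packT, packG]
  | @insert j W hjW ih =>
    have hξj : 0 ≤ ξ j := hξ j (mem_insert_self j W)
    have hξ' : ∀ i ∈ W, 0 ≤ ξ i := fun i hi => hξ i (mem_insert_of_mem hi)
    have key := ih hξ'
    have hΘ1 : packT lam W ξ ≤ 1 := packT_le_one hl hl1 W hξ'
    have hΘ0 : 0 ≤ packT lam W ξ := packT_nonneg hl W hξ'
    have hg1 : 1 ≤ packG lam W ξ := one_le_packG hl W hξ'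
    have hT : packT lam (insert j W) ξ = (1 + lam * ξ j) / (1 + ξ j) * packT lam W ξ := by
      unfold packT; rw [prod_insert hjW]
    have hG : packG lam (insert j W) ξ = (1 + lam * ξ j) * packG lam W ξ := by
      unfold packG; rw [prod_insert hjW]
    rw [hT, hG]
    set Θ := packT lam W ξ with hΘ
    set g := packG lam W ξ with hg
    have hθ := one_sub_theta_le hμ hξj hμ0
    have hθ0 : 0 ≤ 1 - (1 + lam * ξ j) / (1 + ξ j) := by
      rw [sub_nonneg, div_le_one (by linarith)]; nlinarith
    -- K(1 − θΘ) = K(1−Θ) + KΘ(1−θ) ≤ pD(g−1) + K μ ξ_j ≤ pD(g γ_j − 1)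
    have h1 : K * Θ * (1 - (1 + lam * ξ j) / (1 + ξ j)) ≤ K * (μ * ξ j) := by
      calc K * Θ * (1 - (1 + lam * ξ j) / (1 + ξ j)) ≤ K * 1 * (1 - (1 + lam * ξ j) / (1 + ξ j)) :=
            mul_le_mul_of_nonneg_right (mul_le_mul_of_nonneg_left hΘ1 hK0) hθ0
        _ ≤ K * (μ * ξ j) := by rw [mul_one]; exact mul_le_mul_of_nonneg_left hθ hK0
    have h2 : K * (μ * ξ j) = p * lam * D * ξ j := by rw [← mul_assoc, mul_comm K μ, hK]
    have h3 : p * lam * D * ξ j ≤ p * D * (g * (lam * ξ j)) := by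
      have : p * lam * D * ξ j = p * D * (1 * (lam * ξ j)) := by ring
      rw [this]
      exact mul_le_mul_of_nonneg_left (mul_le_mul_of_nonneg_right hg1 (mul_nonneg hl hξj))
        (mul_nonneg hp (by linarith))
    have e : K * (1 - (1 + lam * ξ j) / (1 + ξ j) * Θ) =
        K * (1 - Θ) + K * Θ * (1 - (1 + lam * ξ j) / (1 + ξ j)) := by
      ring
    rw [e]
    nlinarith

/-! ## The bracket of the induction step -/

/-- `θ ≥ γ_D/D` for a petal `ξ ≤ D − 1`: `γ_D ≤ D·(1+λξ)/(1+ξ)` (indeed `D(1+λξ) − γ_D(1+ξ) = μ(D−1−ξ)`). [this work] -/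
theorem gammaD_le_D_mul_theta {lam μ D e : ℝ} (hμ : μ = 1 - lam) (hμ0 : 0 ≤ μ) (he : 0 ≤ e) (heD : e ≤ D - 1) :
    lam * D + μ ≤ D * ((1 + lam * e) / (1 + e)) := by
  have hx : 0 < 1 + e := by linarith
  rw [mul_div_assoc', le_div_iff₀ hx]
  nlinarith [mul_nonneg hμ0 (sub_nonneg.2 heD)]

/-- **The bracket is nonnegative.**  For a tight pack `W` (state `g = packG W`, `Θ = packT W`) and one more petal
`0 ≤ e ≤ D − 1` (`γ_e = 1 + λe`, `θ_e = γ_e/(1+e)`):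
`0 ≤ K·Θ·θ_e + γ_D(μ·g·(gγ_e) + (p−μ)g) − ᾱ`, given `ᾱ = p + K`, `μK = pλD`.  Indeed
`D·B = KΘ(Dθ_e − γ_D) + γ_D(pD(g−1) − K(1−Θ)) + μγ_D D g(gγ_e − 1) ≥ 0` (`packK_le`). [this work] -/
theorem packBracket_nonneg [DecidableEq ι] {lam μ p K D abar : ℝ} (hl : 0 ≤ lam) (hl1 : lam ≤ 1)
    (hμ : μ = 1 - lam) (hp : 0 ≤ p) (hK0 : 0 ≤ K) (hD : 1 ≤ D) (hK : μ * K = p * lam * D)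
    (habar : abar = p + K) (W : Finset ι) {ξ : ι → ℝ} (hξ : ∀ j ∈ W, 0 ≤ ξ j) {e : ℝ} (he : 0 ≤ e)
    (heD : e ≤ D - 1) :
    0 ≤ K * (packT lam W ξ * ((1 + lam * e) / (1 + e))) +
      (lam * D + μ) * (μ * packG lam W ξ * (packG lam W ξ * (1 + lam * e)) + (p - μ) * packG lam W ξ) - abar := by
  have hμ0 : 0 ≤ μ := by rw [hμ]; linarith
  have hΘ0 : 0 ≤ packT lam W ξ := packT_nonneg hl W hξ
  have hg1 : 1 ≤ packG lam W ξ := one_le_packG hl W hξ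
  have hW := packK_le hl hl1 hμ hp hK0 hD hK W hξ
  set Θ := packT lam W ξ with hΘ
  set g := packG lam W ξ with hg
  set th := (1 + lam * e) / (1 + e) with hth
  have hθ : lam * D + μ ≤ D * th := gammaD_le_D_mul_theta hμ hμ0 he heD
  have hγD : 0 ≤ lam * D + μ := by nlinarith
  have hD0 : 0 < D := by linarith
  -- the three nonnegative pieces
  have t1 : 0 ≤ K * Θ * (D * th - (lam * D + μ)) := mul_nonneg (mul_nonneg hK0 hΘ0) (sub_nonneg.2 hθ)
  have t2 : 0 ≤ (lam * D + μ) * (p * D * (g - 1) - K * (1 - Θ)) := mul_nonneg hγD (sub_nonneg.2 hW)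
  have t3 : 0 ≤ μ * (lam * D + μ) * D * g * (g * (1 + lam * e) - 1) := by
    have h1 : 1 ≤ g * (1 + lam * e) := by nlinarith [mul_nonneg hl he]
    exact mul_nonneg (mul_nonneg (mul_nonneg (mul_nonneg hμ0 hγD) hD0.le) (zero_le_one.trans hg1))
      (sub_nonneg.2 h1)
  have key : D * (K * (Θ * th) + (lam * D + μ) * (μ * g * (g * (1 + lam * e)) + (p - μ) * g) - abar) =
      K * Θ * (D * th - (lam * D + μ)) + (lam * D + μ) * (p * D * (g - 1) - K * (1 - Θ)) +
        μ * (lam * D + μ) * D * g * (g * (1 + lam * e) - 1) := by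
    rw [habar]; linear_combination (1 - D) * hK + (D * K + D * p) * hμ
  have hprod : 0 ≤ D * (K * (Θ * th) + (lam * D + μ) * (μ * g * (g * (1 + lam * e)) + (p - μ) * g) - abar) := by
    rw [key]; linarith
  by_contra hneg
  have : D * (K * (Θ * th) + (lam * D + μ) * (μ * g * (g * (1 + lam * e)) + (p - μ) * g) - abar) < 0 :=
    mul_neg_of_pos_of_neg hD0 (not_le.1 hneg)
  linarith

/-! ## The super-dwarf quantity `phiSD` and its induction -/

/-- The (HC) quantity of the super-dwarf hub `(X_T/∏x_j, 1, D)` after absorbing the tight pack `W` exactly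
(see the module docstring; `p = 1 − κ`). [definition, this work] -/
def phiSD (κ lam μ D K abar : ℝ) (W : Finset ι) (ξ : ι → ℝ) : ℝ :=
  lam * (lam * D + μ) * abar - lam * (lam * D + μ) * (K * packT lam W ξ + (1 - κ) * packG lam W ξ) +
    lam * (lam * D + μ) ^ 2 * packS κ lam W ξ * packG lam W ξ -
    (lam * D + μ) ^ 2 * ((1 - κ) - μ * packG lam W ξ) * (packG lam W ξ - 1)

/-- The empty pack: `phiSD ∅ = λγ_D(ᾱ − p − K) = 0`. [this work] -/
theorem phiSD_empty {κ lam μ D K abar : ℝ} (habar : abar = (1 - κ) + K) (ξ : ι → ℝ) :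
    phiSD κ lam μ D K abar (∅ : Finset ι) ξ = 0 := by
  simp only [phiSD, packT, packG, packS, habar, prod_empty, sum_empty]
  ring

/-- **The induction step (identity).**  `phiSD (insert j W) − γ_j·phiSD W = λξ_jγ_D·B` with the bracket `B` of
`packBracket_nonneg` (needs `μᾱ = pγ_D`). [this work] -/
theorem phiSD_insert [DecidableEq ι] {κ lam μ D K abar : ℝ} (hμ : μ = 1 - lam)
    (hI : μ * abar = (1 - κ) * (lam * D + μ)) {W : Finset ι} {j : ι} (hj : j ∉ W) (ξ : ι → ℝ)
    (hγj : 1 + lam * ξ j ≠ 0) (hxj : 1 + ξ j ≠ 0) :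
    phiSD κ lam μ D K abar (insert j W) ξ - (1 + lam * ξ j) * phiSD κ lam μ D K abar W ξ =
      lam * ξ j * (lam * D + μ) *
        (K * (packT lam W ξ * ((1 + lam * ξ j) / (1 + ξ j))) +
          (lam * D + μ) * (μ * packG lam W ξ * (packG lam W ξ * (1 + lam * ξ j)) +
            ((1 - κ) - μ) * packG lam W ξ) - abar) := by
  have hT : packT lam (insert j W) ξ = (1 + lam * ξ j) / (1 + ξ j) * packT lam W ξ := by
    unfold packT; rw [prod_insert hj]
  have hG : packG lam (insert j W) ξ = (1 + lam * ξ j) * packG lam W ξ := by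
    unfold packG; rw [prod_insert hj]
  have hS : packS κ lam (insert j W) ξ = (lam - κ) * ξ j / (1 + lam * ξ j) + packS κ lam W ξ := by
    unfold packS; rw [sum_insert hj]
  unfold phiSD
  rw [hT, hG, hS]
  set Θ := packT lam W ξ
  set g := packG lam W ξ
  set σ := packS κ lam W ξ
  set th := (1 + lam * ξ j) / (1 + ξ j) with hth
  set d := (lam - κ) * ξ j / (1 + lam * ξ j) with hd
  have hth' : th * (1 + ξ j) = 1 + lam * ξ j := div_mul_cancel₀ _ hxj
  have hd' : d * (1 + lam * ξ j) = (lam - κ) * ξ j := div_mul_cancel₀ _ hγj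
  subst hμ
  linear_combination (lam * ξ j * (lam * D + (1 - lam))) * hI +
    (lam * (lam * D + (1 - lam)) ^ 2 * g) * hd' + (-(lam * (lam * D + (1 - lam)) * K * Θ)) * hth'

/-- **STEP 1: (HC) for the super-dwarf hub and every tight pack.**  `0 ≤ phiSD W` for every finset `W` of petals
`0 ≤ ξ_j ≤ D − 1`, under `0 ≤ κ ≤ λ ≤ 1`, `μ = 1−λ`, `D ≥ 1`, `K ≥ 0`, `ᾱ = (1−κ) + K`, `μᾱ = (1−κ)γ_D`. [this work] -/
theorem phiSD_nonneg [DecidableEq ι] {κ lam μ D K abar : ℝ} (hκ0 : 0 ≤ κ) (hκl : κ ≤ lam) (hl1 : lam ≤ 1)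
    (hμ : μ = 1 - lam) (hD : 1 ≤ D) (hK0 : 0 ≤ K) (habar : abar = (1 - κ) + K)
    (hI : μ * abar = (1 - κ) * (lam * D + μ)) (W : Finset ι) {ξ : ι → ℝ} (hξ0 : ∀ j ∈ W, 0 ≤ ξ j)
    (hξD : ∀ j ∈ W, ξ j ≤ D - 1) : 0 ≤ phiSD κ lam μ D K abar W ξ := by
  have hl : 0 ≤ lam := hκ0.trans hκl
  have hμ0 : 0 ≤ μ := by rw [hμ]; linarith
  have hp : 0 ≤ 1 - κ := by linarith
  -- μK = pλD from μᾱ = pγ_D and ᾱ = p + K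
  have hK : μ * K = (1 - κ) * lam * D := by
    have h1 : μ * abar = μ * (1 - κ) + μ * K := by rw [habar]; ring
    rw [hμ] at h1 hI ⊢
    linarith
  induction W using Finset.induction_on with
  | empty => rw [phiSD_empty habar]
  | @insert j W hjW ih =>
    have hξj : 0 ≤ ξ j := hξ0 j (mem_insert_self j W)
    have hξjD : ξ j ≤ D - 1 := hξD j (mem_insert_self j W)
    have hξ0' : ∀ i ∈ W, 0 ≤ ξ i := fun i hi => hξ0 i (mem_insert_of_mem hi)
    have hξD' : ∀ i ∈ W, ξ i ≤ D - 1 := fun i hi => hξD i (mem_insert_of_mem hi)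
    have key := ih hξ0' hξD'
    have hγj : 0 < 1 + lam * ξ j := by nlinarith [mul_nonneg hl hξj]
    have hxj : 0 < 1 + ξ j := by linarith
    have hstep := phiSD_insert (κ := κ) (K := K) hμ hI hjW ξ hγj.ne' hxj.ne'
    have hB := packBracket_nonneg hl hl1 hμ hp hK0 hD hK habar W hξ0' hξj hξjD
    have hγD : 0 ≤ lam * D + μ := by nlinarith
    have h3 : 0 ≤ lam * ξ j * (lam * D + μ) := mul_nonneg (mul_nonneg hl hξj) hγD
    have h4 := mul_nonneg h3 hB
    nlinarith [mul_nonneg hγj.le key]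

/-! ## Pack quantities under `erase` / `Function.update` -/

section update

variable [DecidableEq ι]

/-- Splitting off one petal. [this work] -/
theorem packG_erase (lam : ℝ) {W : Finset ι} {j : ι} (hj : j ∈ W) (ξ : ι → ℝ) :
    packG lam W ξ = (1 + lam * ξ j) * packG lam (W.erase j) ξ := by
  unfold packG; rw [mul_prod_erase W (fun i => 1 + lam * ξ i) hj]

/-- Splitting off one petal. [this work] -/
theorem packS_erase (κ lam : ℝ) {W : Finset ι} {j : ι} (hj : j ∈ W) (ξ : ι → ℝ) :
    packS κ lam W ξ = (lam - κ) * ξ j / (1 + lam * ξ j) + packS κ lam (W.erase j) ξ := by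
  unfold packS; rw [add_sum_erase W (fun i => (lam - κ) * ξ i / (1 + lam * ξ i)) hj]

/-- Splitting off one petal. [this work] -/
theorem prodX_erase {W : Finset ι} {j : ι} (hj : j ∈ W) (ξ : ι → ℝ) :
    ∏ i ∈ W, (1 + ξ i) = (1 + ξ j) * ∏ i ∈ W.erase j, (1 + ξ i) := by
  rw [mul_prod_erase W (fun i => 1 + ξ i) hj]

/-- Replacing one petal. [this work] -/
theorem packG_update (lam : ℝ) {W : Finset ι} {j : ι} (hj : j ∈ W) (ξ : ι → ℝ) (v : ℝ) :
    packG lam W (Function.update ξ j v) = (1 + lam * v) * packG lam (W.erase j) ξ := by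
  rw [packG_erase lam hj, Function.update_self]
  unfold packG
  congr 1
  exact prod_congr rfl fun i hi => by rw [Function.update_of_ne (ne_of_mem_erase hi)]

/-- Replacing one petal. [this work] -/
theorem packT_update (lam : ℝ) {W : Finset ι} {j : ι} (hj : j ∈ W) (ξ : ι → ℝ) (v : ℝ) :
    packT lam W (Function.update ξ j v) = (1 + lam * v) / (1 + v) * packT lam (W.erase j) ξ := by
  unfold packT
  rw [← mul_prod_erase W _ hj, Function.update_self]
  congr 1
  exact prod_congr rfl fun i hi => by rw [Function.update_of_ne (ne_of_mem_erase hi)]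

/-- Replacing one petal. [this work] -/
theorem packS_update (κ lam : ℝ) {W : Finset ι} {j : ι} (hj : j ∈ W) (ξ : ι → ℝ) (v : ℝ) :
    packS κ lam W (Function.update ξ j v) = (lam - κ) * v / (1 + lam * v) + packS κ lam (W.erase j) ξ := by
  unfold packS
  rw [← add_sum_erase W _ hj, Function.update_self]
  congr 1
  exact sum_congr rfl fun i hi => by rw [Function.update_of_ne (ne_of_mem_erase hi)]

/-- Replacing one petal. [this work] -/
theorem prodX_update {W : Finset ι} {j : ι} (hj : j ∈ W) (ξ : ι → ℝ) (v : ℝ) :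
    ∏ i ∈ W, (1 + Function.update ξ j v i) = (1 + v) * ∏ i ∈ W.erase j, (1 + ξ i) := by
  rw [← mul_prod_erase W _ hj, Function.update_self]
  congr 1
  exact prod_congr rfl fun i hi => by rw [Function.update_of_ne (ne_of_mem_erase hi)]

omit [DecidableEq ι] in
/-- `packT · ∏(1+ξ) = packG`. [this work] -/
theorem packT_mul_prodX (lam : ℝ) (W : Finset ι) {ξ : ι → ℝ} (hξ : ∀ j ∈ W, 0 ≤ ξ j) :
    packT lam W ξ * ∏ i ∈ W, (1 + ξ i) = packG lam W ξ := by
  unfold packT packG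
  rw [← prod_mul_distrib]
  exact prod_congr rfl fun i hi => div_mul_cancel₀ _ (by linarith [hξ i hi])

end update

/-! ## The (HC) quantity and its monotonicity -/

/-- `phiHC = ᾱ·gz − λ·gz·A − μ·G·(ᾱ + gz − G)`; (HC) is `0 ≤ phiHC` (`phiHC_eq_hc`). [definition, this work] -/
def phiHC (lam μ abar A G gz : ℝ) : ℝ := abar * gz - lam * gz * A - μ * G * (abar + gz - G)

/-- `phiHC` versus the product form of (HC) used by `star_of_hc`. [this work] -/
theorem phiHC_eq_hc {lam μ abar A G gz : ℝ} (hμ : μ = 1 - lam) :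
    (abar - A) * (gz - μ * G) - μ * (A - G) * (G - gz) = phiHC lam μ abar A G gz := by
  subst hμ; unfold phiHC; ring

/-- `phiHC` is antitone in `A` (`λ, gz ≥ 0`). [this work] -/
theorem phiHC_anti_A {lam μ abar A A' G gz : ℝ} (hl : 0 ≤ lam) (hgz : 0 ≤ gz) (hA : A ≤ A') :
    phiHC lam μ abar A' G gz ≤ phiHC lam μ abar A G gz := by
  unfold phiHC; nlinarith [mul_le_mul_of_nonneg_left hA (mul_nonneg hl hgz)]

/-- `phiHC` is isotone in `gz` when `λA + μG ≤ ᾱ` (e.g. `G ≤ A ≤ ᾱ`, `λ + μ = 1`, `λ, μ ≥ 0`). [this work] -/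
theorem phiHC_mono_gz {lam μ abar A G gz gz' : ℝ} (h : lam * A + μ * G ≤ abar) (hgz : gz ≤ gz') :
    phiHC lam μ abar A G gz ≤ phiHC lam μ abar A G gz' := by
  unfold phiHC; nlinarith [mul_le_mul_of_nonneg_left hgz (sub_nonneg.2 h)]

/-- The `b`-form: for `G = t·g`, `A = g·α_P − t·g·σ`: `phiHC = t·b(t)` with
`b(t) = ᾱ(1 − μg) − λgα_P + t·g(λσ + μ(g−1))`. [this work] -/
theorem phiHC_bform (lam μ abar g aP σ t : ℝ) :
    phiHC lam μ abar (g * aP - t * g * σ) (t * g) t =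
      t * (abar * (1 - μ * g) - lam * g * aP + t * g * (lam * σ + μ * (g - 1))) := by
  unfold phiHC; ring

/-- **Bridge to the super-dwarf theorem**: for the x-saturated super-dwarf state
`A = (1−κ)g + KΘ − γ_D g σ`, `G = γ_D g`, `gz = γ_D`, `phiHC` IS `phiSD`. [this work] -/
theorem phiHC_superdwarf {κ lam μ D K abar : ℝ} (hμ : μ = 1 - lam)
    (hI : μ * abar = (1 - κ) * (lam * D + μ)) (W : Finset ι) (ξ : ι → ℝ) :
    phiHC lam μ abar ((1 - κ) * packG lam W ξ + K * packT lam W ξ - (lam * D + μ) * packG lam W ξ * packS κ lam W ξ)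
        ((lam * D + μ) * packG lam W ξ) (lam * D + μ) = phiSD κ lam μ D K abar W ξ := by
  unfold phiHC phiSD
  set g := packG lam W ξ
  set Θ := packT lam W ξ
  set σ := packS κ lam W ξ
  subst hμ
  linear_combination (-((g - 1) * (lam * D + (1 - lam)))) * hI

end LinkedCurrency

end SafeCalc

end Summit.CriticalPhenomena.PercolationContinuityZ3.Theorems.SunflowerPartition
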